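import Summits.QuantumFields.BalabanUV.T4Continuum.Support.NE7EtaBackgroundEnergyClass
import Summits.QuantumFields.BalabanUV.T4Continuum.Support.NE7EtaBackgroundAllCutoffs
import HarnessLib

/-!
# NE7EtaBackgroundEnergyClassAllCutoffs — route #1 of the NE7 crux, stub S7 (NODE O, the BACKGROUND COORDINATE): the all-cutoffs selection and
# the END's four background-side binders WITH their specification, ON THE ENERGY-CLASS (H∃)ᴱ (`Regular b g`, no sup-form letter)

Cell `pub-balaban`, rung (B)+1 sub-cell t4, lineage `b2b-balaban-t4-ne7-p1`, generation 61 (CRUX PROVER NE7 #1, ruling e34b3e0c (2)); crux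
skeleton `t4/skeletons/NE7-CRUX-R1.md` v1.7.18 §2 (`CruxDecl_of` = END p215546 ∘ node T ∘ NODE O).  HONEST FRAMING (page 1): FIXED FINITE T⁴,
rung (B)+1; NE7, NE3 NOT PRINTED in [Balaban1984PropagatorsI]–[Balaban1989LargeFieldII] and NOT PROVED here; continuum YM on T⁴ ⇐ BetaPertH ∧
nine spine estimates (0/9 proved); BetaPertH ⇐ (D1) ∧ (D4) ∧ CAP+tail; G-an2-4 gates asym, D1 and NE2/3/4; NOT infinite volume, NOT mass
gap, NOT Clay.

WHAT ([folklore]; 0 def; 0 sorry).  `NE7EtaBackgroundAllCutoffs.hclose_of_hmin_all` ∕ `endTowers_spec_occCarriers_of_hmin_all` (p317084 ∕ p317816)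
re-derived with row NE3's (H∃) in ENERGY-CLASS form
  (H∃)ᴱ  `hminE : ∀ V ∈ dom, ∀ k, ∃ U, IsMinimiser 4 (sfClass 4 L N ε) L N k V U ∧ Regular 4 L N b g k U`
(`MinimalActionRate.Regular`: unitary, periodic, small field `b·(L^k)^{−2}`, flux covariant-gradient ENERGY `≤ g·N⁴·(L^k)⁴∕(L^k)⁶`) in place of the
sup-form `hmin` (`MinimalActionRefine.RegularSup b c`), and `0 ≤ g` in place of `gradConst 4 c ≤ g` — through
`NE7EtaBackgroundEnergyClass.hclose_of_hminE_ref`; the letter `c` is GONE; every other hypothesis and BOTH CONCLUSIONS are VERBATIM those of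
p317084 ∕ p317816:
 * §0 THE PRICE OF (H∃)ᴱ, LOCATED (`norm_flux_le`, `norm_covGrad_flux_le`, **`regular_of_mem_sfClass_levelDependent`**,
   `gradFluxSq_le_of_mem_sfClass`; general `d`): class membership ALONE gives the energy-class shape with the LEVEL-DEPENDENT constant
   `g_k = d·#Plane(d)·(4ε·L^k)²` (`‖log W‖ ≤ 2‖W − 1‖`, `Ad` an isometry, `MinimalActionRate.regular_of_sup`) — so (H∃)ᴱ's content beyond
   the class is exactly a gain `(L^k)^{−2} = η²` in `Σ_{period}‖∇_U F‖²`, uniformly in the level: ONE covariant derivative of the flux in `ℓ²`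
   at the physical scale, nothing pointwise;
 * §1 **`hclose_of_hminE_all`** — selections with (a) gauge copies of a minimiser pair for the datum itself at EVERY cutoff on `dom ∖ {v₁}`
   (below the threshold of record a crude pair from (H∃)ᴱ in the trivial gauges, read at distance `≤ 4·(L^K)²`,
   `NE7EtaBackgroundAllCutoffs.plainReading_le_of_unitary`), (b) the tag-`0` reference pair at `v₁` and off `dom`, (b′) `v₁` reads it at every
   cutoff, (c) `hclose` with ONE constant;
 * §2 **`endTowers_spec_occCarriers_of_hminE_all`** — on the boundary carrier over `occCarriers`: the specification (a)(b) AND the END's `hUR`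
   (l.92), `hURB` (l.94), `hURR` (l.96), (F′) `hwit` (l.132) of `TermwiseLocalThm1LedgerW.goodClause_summable_UN_levels_of_thm1At_residualW`
   VERBATIM, from (H∃)ᴱ + NE3's covariant root (amendment 4, ANY real `C, Λ₁, Λ₂′`) + closed-form numerics + `hdom` + the sector condition +
   node U3's shapes for the three kinds + node U2's `InjectedRate` + box∕window∕rate letters.
The sup-form theorems of record are the instances `hminE := hminE_of_hmin hgc hmin` (`NE7EtaBackgroundEnergyClass.hminE_of_hmin`).  Nothing
in the ask of NE3's covariant root (X-A4) changes; (H∃) is asked in the weaker `ℓ²` currency; route 1 stays KERNEL-COMPLETE AT FORM LEVEL ∕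
DEPENDENT; NE7 NOT proved.  HONEST: bookkeeping over landed modules; every analytic input is a HYPOTHESIS; all six functionals are ABSTRACT
(X-A2); nothing of [I]–[III] asserted, instantiated or discharged.
-/

set_option autoImplicit false

open scoped BigOperators Matrix Matrix.Norms.L2Operator
open Finset NormedSpace

namespace Summit.QuantumFields.BalabanUV.T4Continuum.NE7EtaBackgroundEnergyClassAllCutoffs

open Literature.MathematicalPhysics.QuantumFieldTheory.Balaban1983to89
open B7Prop1Explicit B7Prop2Explicit MatrixLog
open T4AveragingDeficitWall hiding Site Plane Plaq Bond
open T4AveragingDeficitWallBoundary (periodBox IsPeriodicCfg)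
open MinimalActionSandwich (IsMinimiser)
open MinimalActionRate (Regular sfClass regular_of_sup)
open AveragingDeficitTransport (norm_Ad_of_unitary)
open MinimalActionLevels (isUnitaryCfg_rescale_bavg)
open T4OutputRate (Carriers Functional NE9 NE5 LipBackground FadingMemory)
open T4BoundaryCarrier (BFunctional atFl NE9Fl LipBackgroundFl NE5B)
open T4TowerRateComposition (PolyLipGrowth URateUpTo)
open T4CauchySum (InjectedRate)
open AveragingDeficitPeriodicCounting (IsPeriodicDir)
open AveragingDeficitTwoLevelPrep (twoLevelSmall)
open NE3EnergyShapes (residualScale IsUnitarySite IsPeriodicSite gaugeAct_one)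
open NE3EnergyWeightedShapes (energyNormW)
open NE7EtaBackgroundCarrier NE7EtaBackgroundCloseness
open TorusSmallFieldGlobalGauge (sectorConst)
open NE7EtaBackgroundReferenceWitness (gauge_refPair)
open NE7EtaBackgroundFamilyDocking (cr_nonneg)
open NE7EtaBackgroundEndTowers (uRateUpTo_of_hclose_indexed uRateUpToFl_of_hclose)
open NE7EtaBackgroundAllCutoffs (plainReading_le_of_unitary)
open NE7EtaBackgroundEnergyClass (hclose_of_hminE_ref)

noncomputable section

/-! ## §0 The trivial, level-dependent instance of (H∃)ᴱ's inequality — the price of (H∃)ᴱ, located -/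

section Trivial

variable {d : ℕ} {n : Type*} [Fintype n] [DecidableEq n]

/-- The flux of a plaquette within `a ≤ ½` of `1` has norm `≤ 2a` (`‖log W‖ ≤ 2‖W − 1‖`, `MatrixLog.norm_mlog_le_two_mul`). [folklore] -/
theorem norm_flux_le {U : Site d → Fin d → (Matrix n n ℂ)ˣ} {a : ℝ} (ha : a ≤ 1 / 2) (hUa : SmallField U a)
    (x : Site d) (π : T4AveragingDeficitWall.Plane d) : ‖flux U (x, π)‖ ≤ 2 * a := by
  have h1 : ‖((fhol U (x, π) : (Matrix n n ℂ)ˣ) : Matrix n n ℂ) - 1‖ ≤ a := hUa x π.1.1 π.1.2 (ne_of_lt π.2)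
  unfold flux
  exact (norm_mlog_le_two_mul (h1.trans ha)).trans (by linarith)

/-- **THE TRIVIAL POINTWISE BOUND**: for `U(N)`-valued `U` in `SmallField U a`, `a ≤ ½`, the covariant gradient of the flux is `≤ 4a` at
every bond and plane (`Ad` is an isometry, `AveragingDeficitTransport.norm_Ad_of_unitary`; no cancellation between the two fluxes is used).
[folklore] -/
theorem norm_covGrad_flux_le [Nonempty n] {U : Site d → Fin d → (Matrix n n ℂ)ˣ} (hU : IsUnitaryCfg U) {a : ℝ} (ha : a ≤ 1 / 2)
    (hUa : SmallField U a) (x : Site d) (κ : Fin d) (π : T4AveragingDeficitWall.Plane d) :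
    ‖covGrad U (flux U) x κ π‖ ≤ 4 * a := by
  unfold covGrad
  refine (norm_sub_le _ _).trans ?_
  rw [norm_Ad_of_unitary (hU x κ)]
  linarith [norm_flux_le ha hUa (x + e κ) π, norm_flux_le ha hUa x π]

/-- **THE PRICE OF (H∃)ᴱ, LOCATED — class membership alone gives the energy-class shape with a LEVEL-DEPENDENT constant**: every
configuration of `sfClass d L N ε k` (`L ≥ 1`, `ε·(L^k)^{−2} ≤ ½`) is `Regular d L N ε g_k k` with `g_k = d·#Plane(d)·(4ε·L^k)²` — the
trivial bound `‖∇_U F‖ ≤ 4ε(L^k)^{−2} = (4εL^k)·(L^k)^{−3}` summed over one period (`MinimalActionRate.regular_of_sup`).  (H∃)ᴱ asks a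
level-FREE `g`, i.e. a gain `(L^k)^{−2} = η²` over this in `Σ_{period}‖∇_U F‖²`: ONE covariant derivative of the flux controlled in `ℓ²` at
the physical scale — that, and nothing pointwise, is what NE7's route 1 asks of the constrained Wilson minimisers beyond their class.
[folklore] -/
theorem regular_of_mem_sfClass_levelDependent [Nonempty n] {L N k : ℕ} (hL : 1 ≤ L) {ε : ℝ}
    (hε : ε / ((L : ℝ) ^ k) ^ 2 ≤ 1 / 2) {U : Site d → Fin d → (Matrix n n ℂ)ˣ} (hU : U ∈ sfClass d L N ε k) :
    Regular d L N ε (d * Fintype.card (T4AveragingDeficitWall.Plane d) * (4 * ε * (L : ℝ) ^ k) ^ 2) k U := by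
  have hLk : (0 : ℝ) < (L : ℝ) ^ k := pow_pos (by exact_mod_cast hL) k
  refine regular_of_sup hU.1 hU.2.1 hU.2.2 fun x κ π => ?_
  refine (norm_covGrad_flux_le hU.1 hε hU.2.2 x κ π).trans (le_of_eq ?_)
  field_simp

/-- Hence the **flux-gradient ENERGY of any configuration of the class** over one period is
`≤ d·#Plane(d)·(4ε·L^k)² · N^d·(L^k)^d∕(L^k)⁶` — the trivial, LEVEL-DEPENDENT instance of the inequality (H∃)ᴱ asks with a level-free
constant (`NE7EtaBackgroundEnergyClass.hminE_of_gradFluxSq`). [folklore] -/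
theorem gradFluxSq_le_of_mem_sfClass [Nonempty n] {L N k : ℕ} (hL : 1 ≤ L) {ε : ℝ}
    (hε : ε / ((L : ℝ) ^ k) ^ 2 ≤ 1 / 2) {U : Site d → Fin d → (Matrix n n ℂ)ˣ} (hU : U ∈ sfClass d L N ε k) :
    gradFluxSq U (periodBox (N * L ^ k))
      ≤ (d * Fintype.card (T4AveragingDeficitWall.Plane d) * (4 * ε * (L : ℝ) ^ k) ^ 2)
          * (N : ℝ) ^ d * ((L : ℝ) ^ k) ^ d / ((L : ℝ) ^ k) ^ 6 :=
  (regular_of_mem_sfClass_levelDependent hL hε hU).grad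

end Trivial

variable {n : Type} [Fintype n] [DecidableEq n] [Nonempty n]

/-! ## §1 The `hclose` binder with minimiser pairs at EVERY cutoff, on (H∃)ᴱ -/

/-- **NODE O's `hclose` BINDER WITHOUT THRESHOLD, ON (H∃)ᴱ** — `NE7EtaBackgroundAllCutoffs.hclose_of_hmin_all` (p317084) with `hmin` replaced by
the energy-class `hminE` (`Regular 4 L N b g k`) and `gradConst 4 c ≤ g` by `0 ≤ g`: below the threshold `K₀` of `hclose_of_hminE_ref` the
selections for `v ∈ dom`, `v ≠ v₁` are a crude minimiser pair from (H∃)ᴱ (run A level `K`, run B level `K+1`, `Regular`) in the trivial gauges,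
read at distance `≤ 4·(L^K)² ≤ (4·(L^{K₀})²·θ^{−K₀})·θ^K`; from `K₀` on, the selections of `hclose_of_hminE_ref`.  CONCLUSION VERBATIM that of
p317084: selections and ONE `C₃ ≥ 0` with (a) gauge copies of a minimiser pair for the datum itself for EVERY `K` on `v ∈ dom ∧ v ≠ v₁`, (b) the
reference pair `(0, 1)` otherwise, (b′) `v₁` reads the reference pair at every cutoff, (c) `hclose`. [folklore] -/
theorem hclose_of_hminE_all {L N : ℕ} (hL : 2 ≤ L) (hN : 1 ≤ N) {θ : ℝ} (hθ : 0 < θ)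
    (hθ6 : θ ^ 6 = ((L : ℝ))⁻¹) {ε b : ℝ} (hb : 0 ≤ b) (hbε : b ≤ ε)
    (hbs : 512 * (4 + 1) * (4 + 4) * (L : ℝ) ^ 2 * b ≤ 1)
    (hε1 : 16 * C0 4 * ε ≤ 3) (h2line : 2 * twoLevelSmall 4 L * ε ≤ (L : ℝ) ^ 2)
    {g C Λ₁ Λ₂' : ℝ} (hg : 0 ≤ g)
    {dom : Set (Site 4 → Fin 4 → (Matrix n n ℂ)ˣ)}
    (hdom : ∀ v ∈ dom, ∀ w : Site 4 → (Matrix n n ℂ)ˣ, IsUnitarySite w → IsPeriodicSite w (N : ℤ) → gaugeAct w v ∈ dom)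
    (hminE : ∀ V ∈ dom, ∀ k : ℕ, ∃ U, IsMinimiser 4 (sfClass 4 L N ε) L N k V U ∧ Regular 4 L N b g k U)
    (h : ∀ k : ℕ, 1 ≤ k → ∀ V ∈ dom, ∀ UA UB : Site 4 → Fin 4 → (Matrix n n ℂ)ˣ,
      IsMinimiser 4 (sfClass 4 L N ε) L N k V UA → IsMinimiser 4 (sfClass 4 L N ε) L N (k + 1) V UB →
        Regular 4 L N b g (k + 1) UB →
        ∃ (u : Site 4 → (Matrix n n ℂ)ˣ) (Z : Site 4 → Fin 4 → Matrix n n ℂ),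
          IsUnitarySite u ∧ IsPeriodicSite u ((N * L ^ k : ℕ) : ℤ) ∧
          IsSkewDir Z ∧ IsPeriodicDir Z ((N * L ^ k : ℕ) : ℤ) ∧
          gaugeAct u UA = vary (rescale L (bavg L UB)) Z 1 ∧
          energyNormW L k (rescale L (bavg L UB)) Z (periodBox (N * L ^ k)) ≤ C * residualScale 4 L N b g k ∧
          (∀ (κ : Fin 4) (x : Site 4) (μ : Fin 4),
            ‖Ad (rescale L (bavg L UB) (x + e κ) μ) (Z (x + e μ) κ) - Z x κ‖ ≤ Λ₁ * (((L : ℝ)⁻¹) ^ k) ^ 2) ∧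
          (∀ (κ μ : Fin 4) (y : Site 4),
            ‖Ad (rescale L (bavg L UB) (y + e κ) μ)
                (Ad (rescale L (bavg L UB) (y + e κ + e μ) μ) (Z (y + (2 : ℕ) • e μ) κ) - Z (y + e μ) κ)
              - (Ad (rescale L (bavg L UB) (y + e κ) μ) (Z (y + e μ) κ) - Z y κ)‖ ≤ Λ₂' * (((L : ℝ)⁻¹) ^ k) ^ 3))
    (hsector : (Fintype.card n : ℝ) * (N : ℝ) ^ 2 * ε ≤ sectorConst n)
    (v₁ : Site 4 → Fin 4 → (Matrix n n ℂ)ˣ)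
    (D : Type) (sc : D → ℕ) (dl : D → ℝ) (hdl : ∀ X, 0 ≤ dl X) :
    ∃ (uA : ℕ → (Site 4 → Fin 4 → (Matrix n n ℂ)ˣ) → (occCarriers n L N ε dom D sc dl hdl).BgA)
      (uB : ℕ → (Site 4 → Fin 4 → (Matrix n n ℂ)ˣ) → (occCarriers n L N ε dom D sc dl hdl).BgB) (C₃ : ℝ),
      0 ≤ C₃ ∧
      (∀ K : ℕ, ∀ v ∈ dom, v ≠ v₁ → ∃ (UA UB : Site 4 → Fin 4 → (Matrix n n ℂ)ˣ) (wA wB : Site 4 → (Matrix n n ℂ)ˣ),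
        IsMinimiser 4 (sfClass 4 L N ε) L N K v UA ∧ IsMinimiser 4 (sfClass 4 L N ε) L N (K + 1) v UB ∧
        Regular 4 L N b g (K + 1) UB ∧ IsUnitarySite wA ∧ IsPeriodicSite wA ((N * L ^ K : ℕ) : ℤ) ∧
        IsUnitarySite wB ∧ IsPeriodicSite wB ((N * L ^ (K + 1) : ℕ) : ℤ) ∧
        (uA K v).1 = (K, gaugeAct wA UA) ∧ (uB K v).1 = (K, gaugeAct wB UB)) ∧
      (∀ (K : ℕ) (v : Site 4 → Fin 4 → (Matrix n n ℂ)ˣ), ¬ (v ∈ dom ∧ v ≠ v₁) →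
        uA K v = ⟨((0 : ℕ), (1 : Site 4 → Fin 4 → (Matrix n n ℂ)ˣ)), one_mem_occA L N ε dom 0⟩ ∧
        uB K v = ⟨((0 : ℕ), (1 : Site 4 → Fin 4 → (Matrix n n ℂ)ˣ)), one_mem_occB L N ε dom 0⟩) ∧
      (∀ K : ℕ, uA K v₁ = ⟨((0 : ℕ), (1 : Site 4 → Fin 4 → (Matrix n n ℂ)ˣ)), one_mem_occA L N ε dom 0⟩ ∧
        uB K v₁ = ⟨((0 : ℕ), (1 : Site 4 → Fin 4 → (Matrix n n ℂ)ˣ)), one_mem_occB L N ε dom 0⟩) ∧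
      ∀ K : ℕ, ∀ v ∈ dom, (occCarriers n L N ε dom D sc dl hdl).gauge (uA K v)
          ((occCarriers n L N ε dom D sc dl hdl).transport (uB K v))
        ≤ C₃ * θ ^ K := by
  classical
  obtain ⟨uA, uB, K₀, C₃, hC₃, hspec, hoff, href, hclose⟩ := hclose_of_hminE_ref hL hN hθ hθ6 hb hbε hbs hε1 h2line hg hdom hminE h
    hsector v₁ D sc dl hdl
  have hθ1 : θ < 1 := theta_lt_one hL hθ hθ6
  have hL1 : 1 ≤ L := le_trans (by norm_num) hL
  have hL1' : (1 : ℝ) ≤ L := by exact_mod_cast hL1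
  -- crude minimiser pairs from (H∃)ᴱ at every cutoff, as total functions
  have hexA' : ∀ (K : ℕ) (v : Site 4 → Fin 4 → (Matrix n n ℂ)ˣ), ∃ UA : Site 4 → Fin 4 → (Matrix n n ℂ)ˣ,
      v ∈ dom → IsMinimiser 4 (sfClass 4 L N ε) L N K v UA := by
    intro K v
    by_cases hv : v ∈ dom
    · obtain ⟨U, hU, -⟩ := hminE v hv K
      exact ⟨U, fun _ => hU⟩
    · exact ⟨1, fun h' => (hv h').elim⟩
  choose fA hfA using hexA'
  have hexB' : ∀ (K : ℕ) (v : Site 4 → Fin 4 → (Matrix n n ℂ)ˣ), ∃ UB : Site 4 → Fin 4 → (Matrix n n ℂ)ˣ,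
      v ∈ dom → IsMinimiser 4 (sfClass 4 L N ε) L N (K + 1) v UB ∧ Regular 4 L N b g (K + 1) UB := by
    intro K v
    by_cases hv : v ∈ dom
    · obtain ⟨U, hU, hreg⟩ := hminE v hv (K + 1)
      exact ⟨U, fun _ => ⟨hU, hreg⟩⟩
    · exact ⟨1, fun h' => (hv h').elim⟩
  choose fB hfB using hexB'
  -- the crude reading of such a pair
  have hcrude : ∀ (K : ℕ) (v : Site 4 → Fin 4 → (Matrix n n ℂ)ˣ), v ∈ dom →
      plainReading L N K (fA K v) (rescale L (bavg L (fB K v))) ≤ 4 * ((L : ℝ) ^ K) ^ 2 := by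
    intro K v hv
    have hreg := (hfB K v hv).2
    have hLK1 : 1 ≤ ((L : ℝ) ^ (K + 1)) ^ 2 := one_le_pow₀ (one_le_pow₀ hL1')
    have hsmall : 512 * (4 + 1) * (4 + 4) * (L : ℝ) ^ 2 * (b / ((L : ℝ) ^ (K + 1)) ^ 2) ≤ 1 :=
      le_trans (mul_le_mul_of_nonneg_left (div_le_self hb hLK1) (by positivity)) hbs
    exact plainReading_le_of_unitary hL1 N K (hfA K v hv).mem.1.1
      (isUnitaryCfg_rescale_bavg L hL1 hreg.unitary (by positivity) hsmall hreg.small)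
  -- the enlarged constant
  set Ccr : ℝ := 4 * ((L : ℝ) ^ K₀) ^ 2 / θ ^ K₀ with hCcr
  have hθK₀ : 0 < θ ^ K₀ := pow_pos hθ K₀
  have hCcr0 : 0 ≤ Ccr := by positivity
  have hcrude' : ∀ K : ℕ, K < K₀ → 4 * ((L : ℝ) ^ K) ^ 2 ≤ (C₃ + Ccr) * θ ^ K := by
    intro K hK
    have h1 : 4 * ((L : ℝ) ^ K) ^ 2 ≤ 4 * ((L : ℝ) ^ K₀) ^ 2 :=
      mul_le_mul_of_nonneg_left (pow_le_pow_left₀ (by positivity) (pow_le_pow_right₀ hL1' hK.le) 2) (by norm_num)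
    have h2 : 4 * ((L : ℝ) ^ K₀) ^ 2 = Ccr * θ ^ K₀ := by rw [hCcr, div_mul_cancel₀ _ hθK₀.ne']
    have h3 : Ccr * θ ^ K₀ ≤ Ccr * θ ^ K := mul_le_mul_of_nonneg_left (pow_le_pow_of_le_one hθ.le hθ1.le hK.le) hCcr0
    have h4 : Ccr * θ ^ K ≤ (C₃ + Ccr) * θ ^ K := mul_le_mul_of_nonneg_right (by linarith) (pow_nonneg hθ.le K)
    linarith
  -- the selections: crude pairs below `K₀` on `dom ∖ {v₁}`, the selections of `hclose_of_hminE_ref` otherwise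
  refine ⟨fun K v => if hc : K < K₀ ∧ v ∈ dom ∧ v ≠ v₁ then
        ⟨(K, fA K v), minimiser_mem_occA L N ε dom K v hc.2.1 _ (hfA K v hc.2.1)⟩ else uA K v,
    fun K v => if hc : K < K₀ ∧ v ∈ dom ∧ v ≠ v₁ then
        ⟨(K, fB K v), minimiser_mem_occB L N ε dom K v hc.2.1 _ (hfB K v hc.2.1).1⟩ else uB K v,
    C₃ + Ccr, add_nonneg hC₃ hCcr0, ?_, ?_, ?_, ?_⟩
  · -- (a) gauge copies of a minimiser pair for the datum itself, at EVERY cutoff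
    intro K v hv hne
    by_cases hK : K < K₀
    · have hc : K < K₀ ∧ v ∈ dom ∧ v ≠ v₁ := ⟨hK, hv, hne⟩
      refine ⟨fA K v, fB K v, fun _ => 1, fun _ => 1, hfA K v hv, (hfB K v hv).1, (hfB K v hv).2,
        fun _ => (unitaryUnits (Matrix n n ℂ)).one_mem, fun _ _ => rfl,
        fun _ => (unitaryUnits (Matrix n n ℂ)).one_mem, fun _ _ => rfl, ?_, ?_⟩
      · simp only [dif_pos hc]; rw [gaugeAct_one]
      · simp only [dif_pos hc]; rw [gaugeAct_one]
    · have hc : ¬ (K < K₀ ∧ v ∈ dom ∧ v ≠ v₁) := fun h' => hK h'.1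
      obtain ⟨UA, UB, wA, wB, hA, hB, hreg, hwAu, hwAp, hwBu, hwBp, heA, heB⟩ := hspec K (not_lt.mp hK) v hv hne
      refine ⟨UA, UB, wA, wB, hA, hB, hreg, hwAu, hwAp, hwBu, hwBp, ?_, ?_⟩
      · simp only [dif_neg hc]; exact heA
      · simp only [dif_neg hc]; exact heB
  · -- (b) the reference pair at `v₁` and off `dom`
    intro K v hKv
    have hc : ¬ (K < K₀ ∧ v ∈ dom ∧ v ≠ v₁) := fun h' => hKv h'.2
    have hKv' : ¬ (K₀ ≤ K ∧ v ∈ dom ∧ v ≠ v₁) := fun h' => hKv h'.2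
    exact ⟨by simp only [dif_neg hc]; exact (hoff K v hKv').1, by simp only [dif_neg hc]; exact (hoff K v hKv').2⟩
  · -- (b′) the reference datum reads the reference pair at every cutoff
    intro K
    have hc : ¬ (K < K₀ ∧ v₁ ∈ dom ∧ v₁ ≠ v₁) := fun h' => h'.2.2 rfl
    exact ⟨by simp only [dif_neg hc]; exact (href K).1, by simp only [dif_neg hc]; exact (href K).2⟩
  · -- (c) `hclose`
    intro K v hv
    by_cases hc : K < K₀ ∧ v ∈ dom ∧ v ≠ v₁
    · simp only [dif_pos hc]
      change levelGauge L N (K, fA K v) (K, rescale L (bavg L (fB K v))) ≤ _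
      rw [levelGauge_same]
      exact (hcrude K v hv).trans (hcrude' K hc.1)
    · simp only [dif_neg hc]
      exact (hclose K v hv).trans (mul_le_mul_of_nonneg_right (by linarith) (pow_nonneg hθ.le K))

/-! ## §2 The END's four background-side binders WITH the selection's specification, on (H∃)ᴱ -/

/-- **THE END's `hUR`, `hURB`, `hURR`, (F′) `hwit` AND THE SPECIFICATION OF THE SAME SELECTIONS, ON THE BOUNDARY CARRIER OVER `occCarriers`,
ON (H∃)ᴱ** (ANY pending-field data `Fl`, `admFl`) — `NE7EtaBackgroundAllCutoffs.endTowers_spec_occCarriers_of_hmin_all` (p317816) with `hmin`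
replaced by the energy-class `hminE` and `gradConst 4 c ≤ g` by `0 ≤ g`; hypotheses otherwise and CONCLUSION VERBATIM: (a) for EVERY cutoff `K`
and every `v ∈ dom`, `v ≠ v₁`, `(uA K v).1 = (K, wA·UA)`, `(uB K v).1 = (K, wB·UB)` for a minimiser pair `UA` (level `K`), `UB` (level `K+1`,
`Regular`) of the datum `v` and unitary periodic gauges `wA`, `wB`; (b) the tag-`0` reference pair `(0, 1)` at `v₁` and off `dom`; then
`Cr, EB₀, CrR ≥ 0` and the END's `hUR` (l.92), `hURB` (l.94), `hURR` (l.96), `hwit` (l.132) VERBATIM with `oneA := (0,1)`, `oneB := (0,1)`,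
`gA K := gtab K`, `gB K := gtab (K+1) (·+1)`, `Adm := dom`.  HONEST: every analytic input is a HYPOTHESIS; all six functionals are ABSTRACT
(X-A2); nothing of NE3∕NE5∕NE9∕NE7 discharged. [folklore] -/
theorem endTowers_spec_occCarriers_of_hminE_all {L N : ℕ} (hL : 2 ≤ L) (hN : 1 ≤ N) {θ : ℝ} (hθ : 0 < θ)
    (hθ6 : θ ^ 6 = ((L : ℝ))⁻¹) {ε b : ℝ} (hb : 0 ≤ b) (hbε : b ≤ ε)
    (hbs : 512 * (4 + 1) * (4 + 4) * (L : ℝ) ^ 2 * b ≤ 1)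
    (hε1 : 16 * C0 4 * ε ≤ 3) (h2line : 2 * twoLevelSmall 4 L * ε ≤ (L : ℝ) ^ 2)
    {g C Λ₁ Λ₂' : ℝ} (hg : 0 ≤ g)
    {dom : Set (Site 4 → Fin 4 → (Matrix n n ℂ)ˣ)}
    (hdom : ∀ v ∈ dom, ∀ w : Site 4 → (Matrix n n ℂ)ˣ, IsUnitarySite w → IsPeriodicSite w (N : ℤ) → gaugeAct w v ∈ dom)
    (hminE : ∀ V ∈ dom, ∀ k : ℕ, ∃ U, IsMinimiser 4 (sfClass 4 L N ε) L N k V U ∧ Regular 4 L N b g k U)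
    (h : ∀ k : ℕ, 1 ≤ k → ∀ V ∈ dom, ∀ UA UB : Site 4 → Fin 4 → (Matrix n n ℂ)ˣ,
      IsMinimiser 4 (sfClass 4 L N ε) L N k V UA → IsMinimiser 4 (sfClass 4 L N ε) L N (k + 1) V UB →
        Regular 4 L N b g (k + 1) UB →
        ∃ (u : Site 4 → (Matrix n n ℂ)ˣ) (Z : Site 4 → Fin 4 → Matrix n n ℂ),
          IsUnitarySite u ∧ IsPeriodicSite u ((N * L ^ k : ℕ) : ℤ) ∧
          IsSkewDir Z ∧ IsPeriodicDir Z ((N * L ^ k : ℕ) : ℤ) ∧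
          gaugeAct u UA = vary (rescale L (bavg L UB)) Z 1 ∧
          energyNormW L k (rescale L (bavg L UB)) Z (periodBox (N * L ^ k)) ≤ C * residualScale 4 L N b g k ∧
          (∀ (κ : Fin 4) (x : Site 4) (μ : Fin 4),
            ‖Ad (rescale L (bavg L UB) (x + e κ) μ) (Z (x + e μ) κ) - Z x κ‖ ≤ Λ₁ * (((L : ℝ)⁻¹) ^ k) ^ 2) ∧
          (∀ (κ μ : Fin 4) (y : Site 4),
            ‖Ad (rescale L (bavg L UB) (y + e κ) μ)
                (Ad (rescale L (bavg L UB) (y + e κ + e μ) μ) (Z (y + (2 : ℕ) • e μ) κ) - Z (y + e μ) κ)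
              - (Ad (rescale L (bavg L UB) (y + e κ) μ) (Z (y + e μ) κ) - Z y κ)‖ ≤ Λ₂' * (((L : ℝ)⁻¹) ^ k) ^ 3))
    (hsector : (Fintype.card n : ℝ) * (N : ℝ) ^ 2 * ε ≤ sectorConst n)
    {v₁ : Site 4 → Fin 4 → (Matrix n n ℂ)ˣ} (hv₁ : v₁ ∈ dom)
    (D : Type) (sc : D → ℕ) (dl : D → ℝ) (hdl : ∀ X, 0 ≤ dl X) (Fl : Type) (admFl : Set Fl)
    -- the shared data: window, decay, history moduli, node U2's output on the printed box, the common rate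
    {W : Set (ℕ → ℝ)} {κ C₉ ω θc Cd γg θ' : ℝ} {Λ : ℕ → ℕ → ℝ} {gtab : ℕ → ℕ → ℝ}
    (hΛ : FadingMemory C₉ ω Λ) (hω : 0 ≤ ω)
    (hinj : InjectedRate Cd 0 θc (fun K j => T4CouplingMatching.disc (gtab K) (gtab (K + 1)) j)) (hCd : 0 ≤ Cd)
    (hθc : 0 ≤ θc) (hbox : ∀ K i, i ≤ K → 0 < gtab K i ∧ gtab K i ≤ γg)
    (hgA : ∀ K, gtab K ∈ W) (hgB : ∀ K, (fun i => gtab (K + 1) (i + 1)) ∈ W)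
    (hθ' : max ω θc < θ') (hθθ' : θ ≤ θ')
    -- E-kind: node U3's shapes for `EA`, `EB`
    {EA : Functional ({ toCarriers := occCarriers n L N ε dom D sc dl hdl, Fl := Fl, admFl := admFl } :
        T4BoundaryCarrier.Carriers).toCarriers (occCarriers n L N ε dom D sc dl hdl).BgA}
    {EB : Functional ({ toCarriers := occCarriers n L N ε dom D sc dl hdl, Fl := Fl, admFl := admFl } :
        T4BoundaryCarrier.Carriers).toCarriers (occCarriers n L N ε dom D sc dl hdl).BgB}
    {θ₅ C₅ P : ℝ} {q : ℕ} {CU : (ℕ → ℝ) → ℕ → ℝ}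
    (h9 : NE9 EA W κ Λ) (hU : LipBackground EA W κ CU) (hG : PolyLipGrowth CU gtab P q) (hP : 0 ≤ P)
    (h5 : NE5 EA EB W κ θ₅ C₅) (hθ₅ : 0 ≤ θ₅) (hC₅ : 0 ≤ C₅) (hθ₅' : θ₅ ≤ θ')
    -- boundary kind: node U3.B's shapes for `BA`, `BB`
    {BA : BFunctional ({ toCarriers := occCarriers n L N ε dom D sc dl hdl, Fl := Fl, admFl := admFl } : T4BoundaryCarrier.Carriers)
        (occCarriers n L N ε dom D sc dl hdl).BgA}
    {BB : BFunctional ({ toCarriers := occCarriers n L N ε dom D sc dl hdl, Fl := Fl, admFl := admFl } : T4BoundaryCarrier.Carriers)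
        (occCarriers n L N ε dom D sc dl hdl).BgB}
    {θ₅B C₅B PB : ℝ} {qB : ℕ} {CUB : (ℕ → ℝ) → ℕ → ℝ}
    (h9B : NE9Fl BA W κ Λ) (hUB : LipBackgroundFl BA W κ CUB) (hGB : PolyLipGrowth CUB gtab PB qB) (hPB : 0 ≤ PB)
    (h5B : NE5B BA BB W κ θ₅B C₅B) (hθ₅B : 0 ≤ θ₅B) (hC₅B : 0 ≤ C₅B) (hθ₅B' : θ₅B ≤ θ')
    -- 𝐑-kind: node U3's shapes for `RA`, `RB`
    {RA : Functional ({ toCarriers := occCarriers n L N ε dom D sc dl hdl, Fl := Fl, admFl := admFl } :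
        T4BoundaryCarrier.Carriers).toCarriers (occCarriers n L N ε dom D sc dl hdl).BgA}
    {RB : Functional ({ toCarriers := occCarriers n L N ε dom D sc dl hdl, Fl := Fl, admFl := admFl } :
        T4BoundaryCarrier.Carriers).toCarriers (occCarriers n L N ε dom D sc dl hdl).BgB}
    {θ₅R C₅R PR : ℝ} {qR : ℕ} {CUR : (ℕ → ℝ) → ℕ → ℝ}
    (h9R : NE9 RA W κ Λ) (hUR' : LipBackground RA W κ CUR) (hGR : PolyLipGrowth CUR gtab PR qR) (hPR : 0 ≤ PR)
    (h5R : NE5 RA RB W κ θ₅R C₅R) (hθ₅R : 0 ≤ θ₅R) (hC₅R : 0 ≤ C₅R) (hθ₅R' : θ₅R ≤ θ') :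
    ∃ (uA : ℕ → (Site 4 → Fin 4 → (Matrix n n ℂ)ˣ) → (occCarriers n L N ε dom D sc dl hdl).BgA)
      (uB : ℕ → (Site 4 → Fin 4 → (Matrix n n ℂ)ˣ) → (occCarriers n L N ε dom D sc dl hdl).BgB) (Cr EB₀ CrR : ℝ),
      -- (a) the specification: gauge copies of a minimiser pair for the datum itself, at EVERY cutoff
      (∀ K : ℕ, ∀ v ∈ dom, v ≠ v₁ → ∃ (UA UB : Site 4 → Fin 4 → (Matrix n n ℂ)ˣ) (wA wB : Site 4 → (Matrix n n ℂ)ˣ),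
        IsMinimiser 4 (sfClass 4 L N ε) L N K v UA ∧ IsMinimiser 4 (sfClass 4 L N ε) L N (K + 1) v UB ∧
        Regular 4 L N b g (K + 1) UB ∧ IsUnitarySite wA ∧ IsPeriodicSite wA ((N * L ^ K : ℕ) : ℤ) ∧
        IsUnitarySite wB ∧ IsPeriodicSite wB ((N * L ^ (K + 1) : ℕ) : ℤ) ∧
        (uA K v).1 = (K, gaugeAct wA UA) ∧ (uB K v).1 = (K, gaugeAct wB UB)) ∧
      -- (b) the reference pair at `v₁` and off `dom`
      (∀ (K : ℕ) (v : Site 4 → Fin 4 → (Matrix n n ℂ)ˣ), ¬ (v ∈ dom ∧ v ≠ v₁) →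
        uA K v = ⟨((0 : ℕ), (1 : Site 4 → Fin 4 → (Matrix n n ℂ)ˣ)), one_mem_occA L N ε dom 0⟩ ∧
        uB K v = ⟨((0 : ℕ), (1 : Site 4 → Fin 4 → (Matrix n n ℂ)ˣ)), one_mem_occB L N ε dom 0⟩) ∧
      0 ≤ Cr ∧ 0 ≤ EB₀ ∧ 0 ≤ CrR ∧
      -- `hUR` (l.92)
      (∀ K : ℕ, URateUpTo K EA EB (gtab K) (fun i => gtab (K + 1) (i + 1)) (uA K) (uB K) dom Cr θ' κ) ∧
      -- `hURB` (l.94)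
      (∀ bfl ∈ admFl, ∀ K : ℕ,
        URateUpTo K (atFl BA bfl) (atFl BB bfl) (gtab K) (fun i => gtab (K + 1) (i + 1)) (uA K) (uB K) dom EB₀ θ' κ) ∧
      -- `hURR` (l.96)
      (∀ K : ℕ, URateUpTo K RA RB (gtab K) (fun i => gtab (K + 1) (i + 1)) (uA K) (uB K) dom CrR θ' κ) ∧
      -- `hwit` (l.132), `oneA := (0, 1)`, `oneB := (0, 1)`, the witness being `v₁` at every cutoff
      (∀ K : ℕ, ∃ v ∈ dom, uA K v = ⟨((0 : ℕ), (1 : Site 4 → Fin 4 → (Matrix n n ℂ)ˣ)), one_mem_occA L N ε dom 0⟩ ∧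
        uB K v = ⟨((0 : ℕ), (1 : Site 4 → Fin 4 → (Matrix n n ℂ)ˣ)), one_mem_occB L N ε dom 0⟩) := by
  obtain ⟨uA, uB, C₃, hC₃, hspec, hoff, href, hclose⟩ := hclose_of_hminE_all hL hN hθ hθ6 hb hbε hbs hε1 h2line hg hdom hminE h
    hsector v₁ D sc dl hdl
  have hθ1 : θ < 1 := theta_lt_one hL hθ hθ6
  -- E-kind: the one-member family
  obtain ⟨a, ha, hE⟩ := uRateUpTo_of_hclose_indexed (Car := occCarriers n L N ε dom D sc dl hdl) (Set.univ : Set Unit)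
    (EAj := fun _ => EA) (EBj := fun _ => EB) (fun _ _ => h9) hΛ hω (fun _ _ => hU) hG hP (fun _ _ => h5) hθ₅ hC₅ hclose hC₃
    hθ.le hθ1 hinj hCd hθc hbox hgA hgB hθ' hθ₅' hθθ'
  -- boundary kind: every admissible pending field, one constant
  obtain ⟨aB, haB, hB⟩ := uRateUpToFl_of_hclose
    (C := ({ toCarriers := occCarriers n L N ε dom D sc dl hdl, Fl := Fl, admFl := admFl } : T4BoundaryCarrier.Carriers))
    h9B hΛ hω hUB hGB hPB h5B hθ₅B hC₅B hclose hC₃ hθ.le hθ1 hinj hCd hθc hbox hgA hgB hθ' hθ₅B' hθθ'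
  -- 𝐑-kind
  obtain ⟨aR, haR, hR⟩ := uRateUpTo_of_hclose_indexed (Car := occCarriers n L N ε dom D sc dl hdl) (Set.univ : Set Unit)
    (EAj := fun _ => RA) (EBj := fun _ => RB) (fun _ _ => h9R) hΛ hω (fun _ _ => hUR') hGR hPR (fun _ _ => h5R) hθ₅R hC₅R hclose
    hC₃ hθ.le hθ1 hinj hCd hθc hbox hgA hgB hθ' hθ₅R' hθθ'
  exact ⟨uA, uB, _, _, _, hspec, hoff, cr_nonneg hΛ hω hCd hbox hC₅ ha hθ', cr_nonneg hΛ hω hCd hbox hC₅B haB hθ',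
    cr_nonneg hΛ hω hCd hbox hC₅R haR hθ', fun K => hE K () (Set.mem_univ _), hB, fun K => hR K () (Set.mem_univ _),
    fun K => ⟨v₁, hv₁, (href K).1, (href K).2⟩⟩

end

end Summit.QuantumFields.BalabanUV.T4Continuum.NE7EtaBackgroundEnergyClassAllCutoffs
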